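import Mathlib
import Summits.Ventures.PercRepro2.TypedStarGroups

/-!
# ONE UNMARKED STAR VERTEX OF ANY DEGREE OVER AN ALL-MARKED BASE, I: CONNECTIVITY (blind cell
PercRepro2, p2 g2, 2026-08-25; sub-claim S1 (C), the degree-`d` form — mine-1's §23.13 six-vertex
class and §24(i) splits read in the kernel)

The degree-3 connectivity lemma of TypedStarConn.lean for a star of ANY degree: an unmarked vertex
`u` whose typed edges `L` (a list, no repetition) all go to marks (`nbr`), over an all-marked loop-free
base `F₀`.

* `cliqueMask s` — the pairs of `K₅` inside the vertex set `s`;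
* `patch L a x` — the configuration `x` with the star edges set by `a`; `imgOpen L a` — the images
  of the neighbours of the OPEN star edges;
* **`conn_iff_patch`** — connections among marks in `patch L a x` are connections in `K₅` at the
  pattern of the base with the clique on `imgOpen L a` forced open;
* **`K3_patch`** — the kernel `K₃` at a patched triple is the kernel of `K₅` at the masked patterns.

Part II (TypedStarGenK5.lean) splits the star off and transports the typed count.  Own code;
standard axioms.
-/

namespace Summit.Ventures.PercRepro2

open Hub

namespace K5

/-! ## Clique masks -/

section Clique

/-- The clique mask of a vertex set of `K₅`: the pairs with both ends in `s`. -/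
def cliqueMask (s : Finset (Fin 5)) : Fin 10 → Bool :=
  fun j => decide ((edge5 j).1 ∈ s ∧ (edge5 j).2 ∈ s)

/-- A pair is in the clique mask iff both its ends are in `s`. -/
lemma cliqueMask_eq_true_iff (s : Finset (Fin 5)) (j : Fin 10) :
    cliqueMask s j = true ↔ ∀ v ∈ ends5 j, v ∈ s := by
  unfold cliqueMask
  rw [decide_eq_true_iff]
  constructor
  · rintro ⟨h1, h2⟩ v hv
    rcases Sym2.mem_iff.1 hv with rfl | rfl
    · exact h1
    · exact h2
  · intro h
    exact ⟨h _ (Sym2.mem_mk_left _ _), h _ (Sym2.mem_mk_right _ _)⟩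

end Clique

/-! ## Patching the star edges -/

section Patch

variable {E : Type*} [DecidableEq E]

/-- The configuration `x` with the edges of `L` set by `a`. -/
def patch (L : List E) (a x : Config E) : Config E := fun e => if e ∈ L then a e else x e

/-- On the list, the patch is `a`. -/
lemma patch_of_mem {L : List E} {a x : Config E} {e : E} (he : e ∈ L) : patch L a x e = a e := by
  simp [patch, he]

/-- Off the list, the patch is `x`. -/
lemma patch_of_not_mem {L : List E} {a x : Config E} {e : E} (he : e ∉ L) : patch L a x e = x e := by
  simp [patch, he]

/-- Patching one more edge. -/
lemma patch_cons (e : E) (L : List E) (a x : Config E) (s : Bool) (he : e ∉ L) :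
    Function.update (patch L a x) e s = patch (e :: L) (Function.update a e s) x := by
  funext e'
  by_cases h : e' = e
  · subst h; simp [patch]
  · by_cases hL : e' ∈ L
    · simp [patch, hL, h]
    · have : e' ∉ e :: L := by simp [h, hL]
      simp [patch, hL, this, Function.update_of_ne h]

end Patch

/-! ## Connectivity through a star vertex of any degree -/

section Conn

variable {V : Type*} {E : Type*} [DecidableEq E]
variable (m : V → Fin 5) (ends : E → Sym2 V) (F₀ : Finset E) {M : Set V}

/-- The images of the neighbours of the open star edges. -/
def imgOpen (nbr : E → V) (L : List E) (a : Config E) : Finset (Fin 5) :=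
  (L.toFinset.filter fun e => a e = true).image fun e => m (nbr e)

/-- Membership in the images of the open star neighbours. -/
lemma mem_imgOpen {nbr : E → V} {L : List E} {a : Config E} {p : Fin 5} :
    p ∈ imgOpen m nbr L a ↔ ∃ e ∈ L, a e = true ∧ m (nbr e) = p := by
  unfold imgOpen
  simp only [Finset.mem_image, Finset.mem_filter, List.mem_toFinset]
  constructor
  · rintro ⟨e, ⟨he, ha⟩, hp⟩; exact ⟨e, he, ha, hp⟩
  · rintro ⟨e, he, ha, hp⟩; exact ⟨e, ⟨he, ha⟩, hp⟩

/-- The star: `u` unmarked, every edge of `L` joins `u` to the mark `nbr e`, `L` without repetition. -/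
structure StarL (M : Set V) (u : V) (nbr : E → V) (L : List E) : Prop where
  hu : u ∉ M
  hnbr : ∀ e ∈ L, ends e = s(u, nbr e) ∧ nbr e ∈ M
  nodup : L.Nodup

variable {m ends F₀}

omit [DecidableEq E] in
/-- A star edge is not in the all-marked part. -/
lemma star_not_mem_of_starL (hM : ∀ e ∈ F₀, ∀ v ∈ ends e, v ∈ M) {u : V} {nbr : E → V} {L : List E}
    (hs : StarL ends M u nbr L) {e : E} (he : e ∈ L) : e ∉ F₀ := fun heF =>
  hs.hu (hM e heF u (by rw [(hs.hnbr e he).1]; exact Sym2.mem_mk_left _ _))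

/-- Two open star neighbours are joined in `K₅` through the clique mask. -/
lemma conn_clique_of_open {nbr : E → V} {L : List E} {a : Config E} {e e' : E} (he : e ∈ L)
    (he' : e' ∈ L) (ha : a e = true) (ha' : a e' = true) (σ₀ : Fin 10 → Bool) :
    Conn ends5 (orOn (cliqueMask (imgOpen m nbr L a)) σ₀) (m (nbr e)) (m (nbr e')) := by
  by_cases heq : m (nbr e) = m (nbr e')
  · rw [heq]; exact conn_refl _ _ _
  obtain ⟨j, hj⟩ := exists_edge5 _ _ heq
  refine conn_of_openAdj ⟨j, ?_, hj⟩
  unfold orOn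
  rw [Bool.or_eq_true]
  right
  rw [cliqueMask_eq_true_iff]
  intro v hv
  rw [hj] at hv
  rcases Sym2.mem_iff.1 hv with rfl | rfl
  · exact (mem_imgOpen m).2 ⟨e, he, ha, rfl⟩
  · exact (mem_imgOpen m).2 ⟨e', he', ha', rfl⟩

/-- **Connections of the patched configuration transfer to the masked pattern.** -/
lemma conn_masked_of_conn_patch (hinj : Set.InjOn m M) (hM : ∀ e ∈ F₀, ∀ v ∈ ends e, v ∈ M)
    (hloop : ∀ e ∈ F₀, ¬ (ends e).IsDiag) {u : V} {nbr : E → V} {L : List E}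
    (hs : StarL ends M u nbr L) {x : Config E} (hx : ClosedOff F₀ x) (a : Config E) {p q : V}
    (hp : p ∈ M) (hq : q ∈ M) (h : Conn ends (patch L a x) p q) :
    Conn ends5 (orOn (cliqueMask (imgOpen m nbr L a)) (patternM m ends F₀ x)) (m p) (m q) := by
  set σ := orOn (cliqueMask (imgOpen m nbr L a)) (patternM m ends F₀ x) with hσ
  set x' := patch L a x with hx'
  let S : Set V := {y | (y ∈ M ∧ Conn ends5 σ (m p) (m y)) ∨
    (y = u ∧ ∃ e ∈ L, a e = true ∧ Conn ends5 σ (m p) (m (nbr e)))}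
  have hS : ∀ y ∈ S, ∀ y', (openGraph ends x').Adj y y' → y' ∈ S := by
    intro y hy y' hadj
    obtain ⟨hne, e, he, hends⟩ := openGraph_adj.1 hadj
    by_cases heL : e ∈ L
    · -- a star edge: `x' e = a e = true`
      have hae : a e = true := by rw [hx', patch_of_mem heL] at he; exact he
      obtain ⟨hend, hnM⟩ := hs.hnbr e heL
      rw [hend] at hends
      rcases Sym2.eq_iff.1 hends with ⟨rfl, rfl⟩ | ⟨rfl, rfl⟩
      · -- from `u` to the neighbour
        rcases hy with ⟨huM, -⟩ | ⟨-, e', he', hae', hc⟩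
        · exact absurd huM hs.hu
        · exact Or.inl ⟨hnM, conn_trans hc (conn_clique_of_open he' heL hae' hae _)⟩
      · -- from the neighbour to `u`
        rcases hy with ⟨-, hc⟩ | ⟨hyu, -⟩
        · exact Or.inr ⟨rfl, e, heL, hae, hc⟩
        · exact absurd hyu hne
    · -- an edge of the all-marked part
      have hxe : x e = true := by rw [hx', patch_of_not_mem heL] at he; exact he
      have heF : e ∈ F₀ := by
        by_contra hF
        rw [hx e hF] at hxe
        exact Bool.false_ne_true hxe
      have hyM : y ∈ M := hM e heF y (by rw [hends]; exact Sym2.mem_mk_left y y')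
      have hy'M : y' ∈ M := hM e heF y' (by rw [hends]; exact Sym2.mem_mk_right y y')
      rcases hy with ⟨-, hc⟩ | ⟨hyu, -⟩
      · exact Or.inl ⟨hy'M, conn_trans hc (conn_mono (le_orOn _ _) (conn_of_openAdj
          (openAdj_patternM m ends F₀ hinj hM hloop hx ⟨e, hxe, hends⟩)))⟩
      · exact absurd (hyu ▸ hyM) hs.hu
  have hqS : q ∈ S := mem_of_conn_of_closed hS (Or.inl ⟨hp, conn_refl _ _ _⟩) h
  rcases hqS with ⟨-, hc⟩ | ⟨hqu, -⟩
  · exact hc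
  · exact absurd (hqu ▸ hq) hs.hu

/-- **Connections of the masked pattern lift to the patched configuration.** -/
lemma conn_patch_of_conn_masked (hinj : Set.InjOn m M) (hM : ∀ e ∈ F₀, ∀ v ∈ ends e, v ∈ M)
    {u : V} {nbr : E → V} {L : List E} (hs : StarL ends M u nbr L) (x : Config E) (a : Config E)
    {p q : V} (hp : p ∈ M) (hq : q ∈ M)
    (h : Conn ends5 (orOn (cliqueMask (imgOpen m nbr L a)) (patternM m ends F₀ x)) (m p) (m q)) :
    Conn ends (patch L a x) p q := by
  set σ := orOn (cliqueMask (imgOpen m nbr L a)) (patternM m ends F₀ x) with hσ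
  set x' := patch L a x with hx'
  -- an open star edge joins `u` to its neighbour in `x'`
  have hjoin : ∀ {e : E}, e ∈ L → a e = true → Conn ends x' u (nbr e) := by
    intro e he hae
    refine conn_of_openAdj ⟨e, ?_, (hs.hnbr e he).1⟩
    rw [hx', patch_of_mem he]; exact hae
  let S : Set (Fin 5) := {r | ∃ y ∈ M, m y = r ∧ Conn ends x' p y}
  have hS : ∀ r ∈ S, ∀ r', (openGraph ends5 σ).Adj r r' → r' ∈ S := by
    intro r hr r' hadj
    obtain ⟨y, hy, hmy, hpy⟩ := hr
    obtain ⟨hne, j, hj, hends⟩ := openGraph_adj.1 hadj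
    rw [hσ] at hj
    unfold orOn at hj
    rw [Bool.or_eq_true] at hj
    rcases hj with hj | hj
    · -- an open pair of the pattern: an open edge of `F₀`
      unfold patternM at hj
      rw [decide_eq_true_iff] at hj
      obtain ⟨e, he, hxe⟩ := hj
      obtain ⟨heF, hmap⟩ := (mem_bundleM m ends F₀).1 he
      obtain ⟨x₁, y₁, hx₁, hy₁, hxy⟩ := ends_eq_of_mem ends F₀ hM heF
      have hx'e : x' e = true := by
        rw [hx', patch_of_not_mem (fun heL => star_not_mem_of_starL hM hs heL heF)]
        exact hxe
      rw [hxy, Sym2.map_mk, hends, Sym2.eq_iff] at hmap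
      rcases hmap with ⟨hm1, hm2⟩ | ⟨hm1, hm2⟩
      · have hxx : x₁ = y := hinj hx₁ hy (hm1.trans hmy.symm)
        refine ⟨y₁, hy₁, hm2, conn_trans hpy (conn_of_openAdj ⟨e, hx'e, ?_⟩)⟩
        rw [hxy, hxx]
      · have hyx : y₁ = y := hinj hy₁ hy (hm2.trans hmy.symm)
        refine ⟨x₁, hx₁, hm1, conn_trans hpy (conn_of_openAdj ⟨e, hx'e, ?_⟩)⟩
        rw [hxy, hyx, Sym2.eq_swap]
    · -- a pair of the clique mask: two open star neighbours
      rw [cliqueMask_eq_true_iff] at hj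
      have hr : r ∈ imgOpen m nbr L a := hj r (by rw [hends]; exact Sym2.mem_mk_left _ _)
      have hr' : r' ∈ imgOpen m nbr L a := hj r' (by rw [hends]; exact Sym2.mem_mk_right _ _)
      obtain ⟨e, he, hae, hme⟩ := (mem_imgOpen m).1 hr
      obtain ⟨e', he', hae', hme'⟩ := (mem_imgOpen m).1 hr'
      have hye : y = nbr e := hinj hy (hs.hnbr e he).2 (hmy.trans hme.symm)
      refine ⟨nbr e', (hs.hnbr e' he').2, hme', ?_⟩
      exact conn_trans hpy (hye ▸ conn_trans (conn_symm (hjoin he hae)) (hjoin he' hae'))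
  obtain ⟨y, hy, hmy, hpy⟩ := mem_of_conn_of_closed hS ⟨p, hp, rfl, conn_refl _ _ _⟩ h
  rwa [hinj hy hq hmy] at hpy

/-- **`Conn ends (patch L a x) p q ↔ Conn ends5 (orOn (cliqueMask (imgOpen L a)) (patternM x)) (m p) (m q)`**. -/
theorem conn_iff_patch (hinj : Set.InjOn m M) (hM : ∀ e ∈ F₀, ∀ v ∈ ends e, v ∈ M)
    (hloop : ∀ e ∈ F₀, ¬ (ends e).IsDiag) {u : V} {nbr : E → V} {L : List E}
    (hs : StarL ends M u nbr L) {x : Config E} (hx : ClosedOff F₀ x) (a : Config E) {p q : V}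
    (hp : p ∈ M) (hq : q ∈ M) :
    Conn ends (patch L a x) p q ↔
      Conn ends5 (orOn (cliqueMask (imgOpen m nbr L a)) (patternM m ends F₀ x)) (m p) (m q) :=
  ⟨conn_masked_of_conn_patch hinj hM hloop hs hx a hp hq,
    conn_patch_of_conn_masked hinj hM hs x a hp hq⟩

end Conn

/-! ## The kernel at a patched triple -/

section Kernel

variable {V : Type*} {E : Type*} [DecidableEq E]
variable {m : V → Fin 5} {ends : E → Sym2 V} {F₀ : Finset E} {M : Set V}
variable {R : Type*} [Field R]

/-- The connection indicator at a patch reads the masked `K₅` connection. -/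
lemma indicator_connEvent_patch (hinj : Set.InjOn m M) (hM : ∀ e ∈ F₀, ∀ v ∈ ends e, v ∈ M)
    (hloop : ∀ e ∈ F₀, ¬ (ends e).IsDiag) {u : V} {nbr : E → V} {L : List E}
    (hs : StarL ends M u nbr L) {x : Config E} (hx : ClosedOff F₀ x) (a : Config E) {p q : V}
    (hp : p ∈ M) (hq : q ∈ M) :
    (connEvent ends p q).indicator (1 : Config E → R) (patch L a x) =
      (connEvent ends5 (m p) (m q)).indicator (1 : Config (Fin 10) → R)
        (orOn (cliqueMask (imgOpen m nbr L a)) (patternM m ends F₀ x)) := by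
  refine indicator_eq_of_iff ?_
  rw [mem_connEvent, mem_connEvent]
  exact conn_iff_patch hinj hM hloop hs hx a hp hq

/-- The avoidance indicator at a patch reads the masked `K₅` avoidance. -/
lemma indicator_avoidAll_patch (hinj : Set.InjOn m M) (hM : ∀ e ∈ F₀, ∀ v ∈ ends e, v ∈ M)
    (hloop : ∀ e ∈ F₀, ¬ (ends e).IsDiag) {u : V} {nbr : E → V} {L : List E}
    (hs : StarL ends M u nbr L) {x : Config E} (hx : ClosedOff F₀ x) (a : Config E) {a₁ a₂ : V}
    (ha₁ : a₁ ∈ M) (ha₂ : a₂ ∈ M) :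
    (avoidAll ends a₂ {a₁}).indicator (1 : Config E → R) (patch L a x) =
      (avoidAll ends5 (m a₂) {m a₁}).indicator (1 : Config (Fin 10) → R)
        (orOn (cliqueMask (imgOpen m nbr L a)) (patternM m ends F₀ x)) := by
  refine indicator_eq_of_iff ?_
  simp only [mem_avoidAll, Finset.mem_singleton, forall_eq]
  rw [conn_iff_patch hinj hM hloop hs hx a ha₂ ha₁]

/-- The `PD` indicator at a patch reads the masked `K₅` `PD`. -/
lemma indicator_PDEvent_patch (hinj : Set.InjOn m M) (hM : ∀ e ∈ F₀, ∀ v ∈ ends e, v ∈ M)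
    (hloop : ∀ e ∈ F₀, ¬ (ends e).IsDiag) {u : V} {nbr : E → V} {L : List E}
    (hs : StarL ends M u nbr L) {x : Config E} (hx : ClosedOff F₀ x) (a : Config E) {a₁ a₂ a₃ : V}
    (ha₁ : a₁ ∈ M) (ha₂ : a₂ ∈ M) (ha₃ : a₃ ∈ M) :
    (PDEvent ends a₁ a₂ a₃).indicator (1 : Config E → R) (patch L a x) =
      (PDEvent ends5 (m a₁) (m a₂) (m a₃)).indicator (1 : Config (Fin 10) → R)
        (orOn (cliqueMask (imgOpen m nbr L a)) (patternM m ends F₀ x)) := by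
  refine indicator_eq_of_iff ?_
  simp only [PDEvent, Dtilde, UnionCluster.inU, Set.mem_inter_iff, Set.mem_compl_iff, Set.mem_union,
    mem_connEvent]
  have hc := fun {p q : V} (hp : p ∈ M) (hq : q ∈ M) => conn_iff_patch hinj hM hloop hs hx a hp hq
  rw [hc ha₁ ha₂, hc ha₃ ha₁, hc ha₃ ha₂]

/-- **The kernel `K₃` at a patched triple is the kernel of `K₅` at the masked patterns.** -/
theorem K3_patch (hinj : Set.InjOn m M) (hM : ∀ e ∈ F₀, ∀ v ∈ ends e, v ∈ M)
    (hloop : ∀ e ∈ F₀, ¬ (ends e).IsDiag) {u : V} {nbr : E → V} {L : List E}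
    (hs : StarL ends M u nbr L) {o a₁ a₂ a₃ b : V} (ho : o ∈ M) (ha₁ : a₁ ∈ M) (ha₂ : a₂ ∈ M)
    (ha₃ : a₃ ∈ M) (hb : b ∈ M) {x y w : Config E} (hx : ClosedOff F₀ x) (hy : ClosedOff F₀ y)
    (hw : ClosedOff F₀ w) (a b' c : Config E) :
    CovForm.K3 (R := R) ends o a₁ a₂ a₃ b (patch L a x) (patch L b' y) (patch L c w) =
      CovForm.K3 (R := R) ends5 (m o) (m a₁) (m a₂) (m a₃) (m b)
        (orOn (cliqueMask (imgOpen m nbr L a)) (patternM m ends F₀ x))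
        (orOn (cliqueMask (imgOpen m nbr L b')) (patternM m ends F₀ y))
        (orOn (cliqueMask (imgOpen m nbr L c)) (patternM m ends F₀ w)) := by
  unfold CovForm.K3 CovForm.sepKernel CovForm.f3 CovForm.f4 CovForm.f5 CovForm.f6 CovForm.f7 CovForm.f10
    CovForm.f11 CovForm.f12 CovForm.sigma CovForm.inU CovForm.iQ CovForm.iPD CovForm.iL CovForm.iH
  simp only [Fin.sum_univ_succ, Fin.sum_univ_zero, Matrix.cons_val_zero, Matrix.cons_val_succ, add_zero,
    indicator_connEvent_patch hinj hM hloop hs hx, indicator_connEvent_patch hinj hM hloop hs hy,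
    indicator_connEvent_patch hinj hM hloop hs hw, indicator_avoidAll_patch hinj hM hloop hs hx,
    indicator_avoidAll_patch hinj hM hloop hs hy, indicator_avoidAll_patch hinj hM hloop hs hw,
    indicator_PDEvent_patch hinj hM hloop hs hx, indicator_PDEvent_patch hinj hM hloop hs hy,
    indicator_PDEvent_patch hinj hM hloop hs hw, ho, ha₁, ha₂, ha₃, hb]

end Kernel

end K5

end Summit.Ventures.PercRepro2
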